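import Summits.Ventures.LatticeQCDFlow.Scaling.SectorExactManySectorsLaw
import Summits.Ventures.LatticeQCDFlow.Scaling.StarSlowSwapLaw

/-!
HONEST FRAMING: exact (Metropolis-corrected) sampling algorithms for lattice gauge theory; figures
of merit are autocorrelation/cost numbers at stated couplings and volumes; no continuum-physics
claim.

# SectorExactSlowSwapLaw — ITEM 1 FOR PARTITION-EXACT FLOWS WITH ANY NUMBER OF SECTORS AT SLOW SWAPS, WITHOUT THE LABEL ENTROPY:
# `d(n) ≤ ((θ+K)/θ)(1−δ)^{⌊n/2⌋} + (eK/(p·W_lo) + 1)·e^{−hρn/4}`, `ρ = (t/(t+h))·(p/3)/K`, AND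
# `t_mix(ε) ≤ max{2⌈ρ₁⁻¹·log(2(1+K(2t+h)/(2t))/ε)⌉, ⌈(12K(t+h)/(p·h·t))·log(2(eK/(p·W_lo)+1)/ε)⌉}` FOR `4t ≤ h` (lean-2 GEN-34, ours)

Venture-side (OURS).  Cell `lqcd-flow` (pub-lqcd), unit `pub-lqcd-lean-2-g34`, 2026-08-29.  Chapter U, file 4.  `Scaling/SectorExactManySectorsLaw` (Q14) bounded the `q`-point LABEL STAR
of a partition-exact flow hub spectrally, paying the label entropy `log(1/π̃^L_min) ≤ (K+1)·log(1/w_min)`, and named what item 1 still asked for `q ≥ 3`: the label star's own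
cold-start law by coupling.  Chapter U supplies it at slow swaps (`StarSlowSwapLaw`, the persistence-weighted disagreement count): here Q14's assembly is repeated with that law in
place of the spectral bound.  THE MODEL: a finite `S` partitioned by `ℓ : S → L` into ANY number of sectors; a hot law `μ_0` and `K` cold levels of ONE law `μ_1` (all masses
positive); entry bijections preserving the sectors and exact on each of them up to its weight, `μ_1(φ_r u) = c_r(ℓu)·μ_0(u)`, with `p·c_r(b) ≤ 1` (`p > 0`); a UNIFORM entry list
(`c ≥ 1` entries per level); exact hot redraws (weight `w_0 > 0`); `μ_1`-stationary, sector-confined, row-stochastic cold kernels; `0 < t < 1`; `W_lo > 0` a lower bound for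
`max{W(b), W(b')}` over label pairs `b ≠ b'`, `W(b) = μ_1(ℓ = b)/μ_0(ℓ = b)` the sector weight ratio (`= c_r(b)`); SLOW SWAPS `4t ≤ h = (1−t)w_0`.

## What is proved

* `labelStar_hom` (the label laws of homogeneous cold laws are homogeneous; hub domination of the label law), `labelKernel_ite_symm`;
* **`sectorExact_worstTvDist_le_slowSwap`** — for `0 < θ ≤ 1`, `(1−θ)t ≤ hθ`:
  **`d(n) ≤ ((θ+K)/θ)(1 − min{h(1−θ)pct/m, (hθ−(1−θ)t)/(K+θ)})^{⌊n/2⌋} + (e·(K·(1/(p·W_lo))) + 1)·exp(−(hρ/4)·n)`**, `ρ = (t/(t+h))·(p/3)/K`;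
* **`sectorExact_mixingTime_le_slowSwap`** (`θ = 2t/(2t+h)`):
  **`t_mix(ε) ≤ max{2⌈ρ₁⁻¹·log(2(1+K(2t+h)/(2t))/ε)⌉₊, ⌈(4/(hρ))·log(2(e·(K·(1/(p·W_lo)))+1)/ε)⌉₊}`**, `ρ₁ = (th/(2t+h))·min{hpc/m, 1/(K+1)}` —
  `O((K + m/(hpc))·(1/t)·log(K/ε) + (K/(p·t))·log(K/(p·W_lo·ε)))` at `4t ≤ h`: polynomial in `K`, linear in `1/p`, free of `|S|`, of `π̃_min`, of any regime AND of the label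
  entropy — the laws enter through `p` and, inside the logarithm, `W_lo`.

Reading (no numerics implied): the topological-freezing use case of OPEN-MATH item 1 with ANY number of sectors — `K` cold replicas of the target with sector-confined samplers, a
flow hub exact on each sector and under-weighting none by more than the factor `p`, exact accept/reject, one swap offer per four hub refreshes or fewer — mixes from the worst
start in `O((K/(p·t))·log(K/(p·W_lo·ε)))` steps.  NOT CLAIMED: fast swaps (`t ≫ h`) for `q ≥ 3` sectors (open: chapter U's potential is environment-free); flows inexact within a
sector; heterogeneous cold laws; anything measured.  Literature grade (cell rule): OWN; nothing cited as a fact; no new bib keys.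
-/

noncomputable section

open Finset Function
open Literature.Probability.MarkovChains

namespace Summit.Ventures.LatticeQCDFlow.Scaling

variable {S : Type*} [Fintype S] [DecidableEq S] {K m : ℕ} {μ : Fin (K + 1) → S → ℝ} {M : Fin (K + 1) → S → S → ℝ}
  {w : Fin (K + 1) → ℝ} {t : ℝ}

section SlowSwap
variable (κ : Fin m → Fin K) (φ : Fin m → Equiv.Perm S) {L : Type*} [Fintype L] [DecidableEq L] (ℓ : S → L)

omit [Fintype S] [DecidableEq S] [Fintype L] in
/-- `𝟙{u = v} = 𝟙{v = u}` as real indicators. [ours] -/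
theorem labelKernel_ite_symm (u v : L) : (if u = v then (1 : ℝ) else 0) = if v = u then 1 else 0 := by
  by_cases h : u = v
  · subst h; rfl
  · rw [if_neg h, if_neg (Ne.symm h)]

omit [DecidableEq S] in
/-- Homogeneous cold laws have homogeneous label laws, dominated by the hub's label law: `μ^L_{i+1} = μ^L_1`, `p·μ^L_1 ≤ μ^L_0` (`m ≥ 1`). [ours] -/
theorem labelStar_hom (hm : 1 ≤ m) (hμ1 : ∀ k, ∑ u, μ k u = 1) (hhom : ∀ i : Fin K, μ i.succ = μ 1) (hφℓ : ∀ r u, ℓ (φ r u) = ℓ u) {cL : Fin m → L → ℝ}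
    (hexact : ∀ r u, μ (κ r).succ (φ r u) = cL r (ℓ u) * μ 0 u)
    {μB : Fin (K + 1) → L → ℝ} (hμB : ∀ k b, μB k b = ∑ u ∈ univ.filter (fun u => ℓ u = b), μ k u) (hμB0 : ∀ k b, 0 < μB k b)
    {p : ℝ} (hpc : ∀ r b, p * cL r b ≤ 1) :
    (∀ i : Fin K, μB i.succ = μB 1) ∧ (∀ b, p * μB 1 b ≤ μB 0 b) := by
  have hhomB : ∀ i : Fin K, μB i.succ = μB 1 := fun i => by funext b; rw [hμB, hμB, hhom]
  obtain ⟨-, -, -, -, hdomB⟩ := labelStar_basic κ φ ℓ hμ1 hφℓ hexact hμB hμB0 hpc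
  refine ⟨hhomB, fun b => ?_⟩
  have h := hdomB ⟨0, hm⟩ b
  simp only [Equiv.refl_apply] at h
  rwa [hhomB] at h

/-- **THE DISTANCE PROFILE WITH PARTITION-EXACT FLOWS, ANY NUMBER OF SECTORS, SLOW SWAPS:** for `0 < θ ≤ 1`, `(1−θ)t ≤ (1−t)w_0θ`, `4t ≤ (1−t)w_0`,
**`d(n) ≤ ((θ+K)/θ)(1 − min{(1−t)w_0(1−θ)pct/m, ((1−t)w_0θ−(1−θ)t)/(K+θ)})^{⌊n/2⌋} + (e·(K·(1/(p·W_lo))) + 1)·exp(−((1−t)w_0·ρ/4)·n)`**, `ρ = (t/(t+(1−t)w_0))·(p/3)/K`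
— the stale mass of `SectorExactHubDominationLaw` plus the label star's slow-swap law (`StarSlowSwapLaw`). [ours] -/
theorem sectorExact_worstTvDist_le_slowSwap [Nonempty L] (hm : 1 ≤ m) (ht0 : 0 < t) (ht1 : t < 1) (hw0 : ∀ k, 0 ≤ w k)
    (hw00 : 0 < w 0) (hw1 : ∑ k, w k = 1) (hμ : ∀ k x, 0 < μ k x) (hμ1 : ∀ k, ∑ u, μ k u = 1) (hhom : ∀ i : Fin K, μ i.succ = μ 1)
    (hφℓ : ∀ r u, ℓ (φ r u) = ℓ u)
    {cL : Fin m → L → ℝ} (hcL : ∀ r b, 0 < cL r b) (hexact : ∀ r u, μ (κ r).succ (φ r u) = cL r (ℓ u) * μ 0 u)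
    (hM : ∀ k, IsRowStochastic (M k)) (hM0 : ∀ u v, M 0 u v = μ 0 v)
    (hstat : ∀ k : Fin (K + 1), k ≠ 0 → ∀ v, ∑ u, μ k u * M k u v = μ k v)
    (hconf : ∀ k : Fin (K + 1), k ≠ 0 → ∀ u v, ℓ u ≠ ℓ v → M k u v = 0)
    {μB : Fin (K + 1) → L → ℝ} (hμB : ∀ k b, μB k b = ∑ u ∈ univ.filter (fun u => ℓ u = b), μ k u)
    (hμB0 : ∀ k b, 0 < μB k b) {p θ : ℝ} (hp0 : 0 < p) (hpc : ∀ r b, p * cL r b ≤ 1) (hθ0 : 0 < θ) (hθ1 : θ ≤ 1)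
    (hreg : (1 - θ) * t ≤ (1 - t) * w 0 * θ) {c : ℕ} (hunif : ∀ i : Fin K, (univ.filter fun r : Fin m => κ r = i).card = c)
    {Wlo : ℝ} (hWlo0 : 0 < Wlo) (hWlo : ∀ b b', b ≠ b' → Wlo ≤ max (μB 1 b / μB 0 b) (μB 1 b' / μB 0 b'))
    (hslow : 4 * t ≤ (1 - t) * w 0) (n : ℕ) :
    worstTvDist (fun y z : Fin (K + 1) → S =>
        t * ptGraphSwap μ (fun r : Fin m => (((0 : Fin (K + 1)), (κ r).succ) : Fin (K + 1) × Fin (K + 1))) φ y z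
          + (1 - t) * prodKernel w M y z) (tensorFun μ) n
      ≤ (θ + K) / θ * (1 - min ((1 - t) * w 0 * (1 - θ) * p * c * t / m) (((1 - t) * w 0 * θ - (1 - θ) * t) / (K + θ))) ^ (n / 2)
        + (Real.exp 1 * (K * (1 / (p * Wlo))) + 1) * Real.exp (-((1 - t) * w 0 * (t / (t + (1 - t) * w 0) * (p / 3) / K) / 4) * n) := by
  obtain ⟨hμB1, -, -, -, -⟩ := labelStar_basic κ φ ℓ hμ1 hφℓ hexact hμB hμB0 hpc
  obtain ⟨hhomB, hdomB⟩ := labelStar_hom κ φ ℓ hm hμ1 hhom hφℓ hexact hμB hμB0 hpc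
  have h1 := sectorExact_worstTvDist_le_labelStar_dom κ φ ℓ hm ht0.le ht1.le hw0 hw1 hμ hμ1 hφℓ hcL hexact hM hM0 hstat hconf hμB hμB0
    hp0.le hpc hθ0 hθ1 hreg (c := c) (fun i => (hunif i).ge) n
  have hidle : ∀ (i : Fin K) (u v : L), (fun (k : Fin (K + 1)) (u v : L) => if k = 0 then μB 0 v else (if u = v then (1 : ℝ) else 0)) i.succ u v
      = if v = u then 1 else 0 := fun i u v => by
    show (if i.succ = (0 : Fin (K + 1)) then μB 0 v else (if u = v then (1 : ℝ) else 0)) = if v = u then 1 else 0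
    rw [if_neg (Fin.succ_ne_zero i), labelKernel_ite_symm]
  have h2 : worstTvDist (fun y s : Fin (K + 1) → L =>
        t * ptGraphSwap μB (fun r : Fin m => (((0 : Fin (K + 1)), (κ r).succ) : Fin (K + 1) × Fin (K + 1))) (fun _ : Fin m => Equiv.refl L) y s
          + (1 - t) * prodKernel w (fun (k : Fin (K + 1)) (u v : L) => if k = 0 then μB 0 v else (if u = v then (1 : ℝ) else 0)) y s) (tensorFun μB) n
      ≤ (Real.exp 1 * (K * (1 / (p * Wlo))) + 1) * Real.exp (-((1 - t) * w 0 * (t / (t + (1 - t) * w 0) * (p / 3) / K) / 4) * n) :=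
    homStar_worstTvDist_le_slowSwap κ (μ := μB) (M := fun (k : Fin (K + 1)) (u v : L) => if k = 0 then μB 0 v else (if u = v then (1 : ℝ) else 0))
      hm ht0 ht1 hw0 hw00 hw1 hμB0 hμB1 (fun u v => by simp) hidle hhomB hunif hp0 hdomB hWlo0 hWlo hslow n
  linarith [h1, h2]

/-- **THE MIXING TIME WITH PARTITION-EXACT FLOWS, ANY NUMBER OF SECTORS, SLOW SWAPS** (`θ = 2t/(2t+h)`, `h = (1−t)w_0`, `4t ≤ h`):
**`t_mix(ε) ≤ max{2⌈ρ₁⁻¹·log(2(1+K(2t+h)/(2t))/ε)⌉₊, ⌈(4/(hρ))·log(2(e·(K·(1/(p·W_lo))) + 1)/ε)⌉₊}`**, `ρ₁ = (th/(2t+h))·min{hpc/m, 1/(K+1)}`, `ρ = (t/(t+h))·(p/3)/K` —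
no `|S|`, no `π̃_min`, no regime, no label entropy. [ours] -/
theorem sectorExact_mixingTime_le_slowSwap [Nonempty L] (hm : 1 ≤ m) (ht0 : 0 < t) (ht1 : t < 1) (hw0 : ∀ k, 0 ≤ w k)
    (hw00 : 0 < w 0) (hw1 : ∑ k, w k = 1) (hμ : ∀ k x, 0 < μ k x) (hμ1 : ∀ k, ∑ u, μ k u = 1) (hhom : ∀ i : Fin K, μ i.succ = μ 1)
    (hφℓ : ∀ r u, ℓ (φ r u) = ℓ u)
    {cL : Fin m → L → ℝ} (hcL : ∀ r b, 0 < cL r b) (hexact : ∀ r u, μ (κ r).succ (φ r u) = cL r (ℓ u) * μ 0 u)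
    (hM : ∀ k, IsRowStochastic (M k)) (hM0 : ∀ u v, M 0 u v = μ 0 v)
    (hstat : ∀ k : Fin (K + 1), k ≠ 0 → ∀ v, ∑ u, μ k u * M k u v = μ k v)
    (hconf : ∀ k : Fin (K + 1), k ≠ 0 → ∀ u v, ℓ u ≠ ℓ v → M k u v = 0)
    {μB : Fin (K + 1) → L → ℝ} (hμB : ∀ k b, μB k b = ∑ u ∈ univ.filter (fun u => ℓ u = b), μ k u)
    (hμB0 : ∀ k b, 0 < μB k b) {p : ℝ} (hp0 : 0 < p) (hpc : ∀ r b, p * cL r b ≤ 1)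
    {c : ℕ} (hc1 : 1 ≤ c) (hunif : ∀ i : Fin K, (univ.filter fun r : Fin m => κ r = i).card = c)
    {Wlo : ℝ} (hWlo0 : 0 < Wlo) (hWlo : ∀ b b', b ≠ b' → Wlo ≤ max (μB 1 b / μB 0 b) (μB 1 b' / μB 0 b'))
    (hslow : 4 * t ≤ (1 - t) * w 0) {ε : ℝ} (hε : 0 < ε) :
    mixingTime (fun y z : Fin (K + 1) → S =>
        t * ptGraphSwap μ (fun r : Fin m => (((0 : Fin (K + 1)), (κ r).succ) : Fin (K + 1) × Fin (K + 1))) φ y z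
          + (1 - t) * prodKernel w M y z) (tensorFun μ) ε
      ≤ max (2 * ⌈1 / (t * ((1 - t) * w 0) / (2 * t + (1 - t) * w 0) * min ((1 - t) * w 0 * p * c / m) (1 / (K + 1)))
              * Real.log (2 * (1 + K * (2 * t + (1 - t) * w 0) / (2 * t)) / ε)⌉₊)
          ⌈1 / ((1 - t) * w 0 * (t / (t + (1 - t) * w 0) * (p / 3) / K) / 4)
              * Real.log (2 * (Real.exp 1 * (K * (1 / (p * Wlo))) + 1) / ε)⌉₊ := by
  set h := (1 - t) * w 0 with hh
  have hh0 : 0 < h := mul_pos (by linarith) hw00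
  have hmpos : (0 : ℝ) < m := Nat.cast_pos.mpr (by omega)
  have hcpos : (0 : ℝ) < c := Nat.cast_pos.mpr (by omega)
  have hmK : (m : ℝ) = c * K := uniformList_card κ hunif
  have hKpos : (0 : ℝ) < K := by
    rcases Nat.eq_zero_or_pos K with hK0 | hK0
    · exfalso; rw [hK0] at hmK; simp at hmK; omega
    · exact_mod_cast hK0
  -- the tuned `θ`
  set θ := 2 * t / (2 * t + h) with hθ
  have hθ0 : 0 < θ := by positivity
  have hθ1 : θ ≤ 1 := by rw [hθ, div_le_one (by positivity)]; linarith
  have h1θ : 1 - θ = h / (2 * t + h) := by rw [hθ]; field_simp; ring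
  have hreg : (1 - θ) * t ≤ (1 - t) * w 0 * θ := by
    rw [h1θ, ← hh, hθ]
    rw [div_mul_eq_mul_div, mul_div_assoc', div_le_div_iff_of_pos_right (by positivity)]
    nlinarith [mul_pos ht0 hh0]
  -- the two rates
  set ρ := t * h / (2 * t + h) * min (h * p * c / m) (1 / (K + 1)) with hρ
  have hρ0 : 0 < ρ := by
    have : 0 < min (h * p * c / (m : ℝ)) (1 / ((K : ℝ) + 1)) := lt_min (by positivity) (by positivity)
    positivity
  have hρ1 : ρ ≤ 1 := by
    have h1 : t * h / (2 * t + h) ≤ 1 := by rw [div_le_one (by positivity)]; nlinarith [mul_pos ht0 hh0]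
    have h2 : min (h * p * c / (m : ℝ)) (1 / ((K : ℝ) + 1)) ≤ 1 := (min_le_right _ _).trans (by
      rw [div_le_one (by positivity)]; linarith [Nat.cast_nonneg (α := ℝ) K])
    have h3 : 0 ≤ min (h * p * c / (m : ℝ)) (1 / ((K : ℝ) + 1)) := le_min (by positivity) (by positivity)
    calc ρ ≤ 1 * 1 := mul_le_mul h1 h2 h3 zero_le_one
      _ = 1 := one_mul 1
  set a := h * (t / (t + h) * (p / 3) / K) / 4 with ha
  have ha0 : 0 < a := by positivity
  set C₁ := 1 + K * (2 * t + h) / (2 * t) with hC₁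
  have hC₁0 : 0 < C₁ := by positivity
  set C₂ := Real.exp 1 * (K * (1 / (p * Wlo))) + 1 with hC₂
  have hC₂0 : 0 < C₂ := by positivity
  set N₁ : ℕ := ⌈1 / ρ * Real.log (2 * C₁ / ε)⌉₊ with hN₁
  set N₂ : ℕ := ⌈1 / a * Real.log (2 * C₂ / ε)⌉₊ with hN₂
  set n : ℕ := max (2 * N₁) N₂ with hn
  -- the law at time `n`
  have hlaw := sectorExact_worstTvDist_le_slowSwap κ φ ℓ hm ht0 ht1 hw0 hw00 hw1 hμ hμ1 hhom hφℓ hcL hexact hM hM0 hstat hconf hμB hμB0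
    hp0 hpc hθ0 hθ1 hreg hunif hWlo0 hWlo hslow n
  -- compare the stale rate with `ρ` and the constant with `C₁`
  have hrate : ρ ≤ min ((1 - t) * w 0 * (1 - θ) * p * c * t / m) (((1 - t) * w 0 * θ - (1 - θ) * t) / (K + θ)) := by
    refine le_min ?_ ?_
    · calc ρ ≤ t * h / (2 * t + h) * (h * p * c / m) := mul_le_mul_of_nonneg_left (min_le_left _ _) (by positivity)
        _ = (1 - t) * w 0 * (1 - θ) * p * c * t / m := by rw [h1θ, ← hh]; ring
    · calc ρ ≤ t * h / (2 * t + h) * (1 / (K + 1)) := mul_le_mul_of_nonneg_left (min_le_right _ _) (by positivity)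
        _ ≤ t * h / (2 * t + h) * (1 / (K + θ)) := by gcongr
        _ = ((1 - t) * w 0 * θ - (1 - θ) * t) / (K + θ) := by rw [← hh, h1θ, hθ]; field_simp; ring
  have hconst : (θ + K) / θ = C₁ := by rw [hC₁, hθ]; field_simp
  have hbase0 : 0 ≤ 1 - min ((1 - t) * w 0 * (1 - θ) * p * c * t / m) (((1 - t) * w 0 * θ - (1 - θ) * t) / (K + θ)) := by
    have h2 : min ((1 - t) * w 0 * (1 - θ) * p * c * t / m) (((1 - t) * w 0 * θ - (1 - θ) * t) / (K + θ))
        ≤ ((1 - t) * w 0 * θ - (1 - θ) * t) / (K + θ) := min_le_right _ _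
    have h3 : ((1 - t) * w 0 * θ - (1 - θ) * t) / (K + θ) ≤ 1 := by
      rw [div_le_one (by positivity)]
      have hw01 : w 0 ≤ 1 := by
        calc w 0 ≤ ∑ k, w k := Finset.single_le_sum (fun k _ => hw0 k) (mem_univ 0)
          _ = 1 := hw1
      nlinarith [mul_nonneg (sub_nonneg.mpr ht1.le) (hw0 0), mul_nonneg (sub_nonneg.mpr hθ1) ht0.le, hθ0.le,
        mul_le_mul_of_nonneg_left hw01 (sub_nonneg.mpr ht1.le), Nat.cast_nonneg (α := ℝ) K]
    linarith
  -- first term `≤ ε/2`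
  have hn1 : N₁ ≤ n / 2 := by omega
  have hfirst : (θ + K) / θ * (1 - min ((1 - t) * w 0 * (1 - θ) * p * c * t / m)
      (((1 - t) * w 0 * θ - (1 - θ) * t) / (K + θ))) ^ (n / 2) ≤ ε / 2 := by
    have hg := geom_le_of_ge_log hρ0 hρ1 (by positivity : 0 < 2 * C₁) hε (n := N₁) (Nat.le_ceil _)
    calc (θ + K) / θ * (1 - min ((1 - t) * w 0 * (1 - θ) * p * c * t / m) (((1 - t) * w 0 * θ - (1 - θ) * t) / (K + θ))) ^ (n / 2)
        ≤ C₁ * (1 - ρ) ^ (n / 2) := by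
          rw [hconst]
          exact mul_le_mul_of_nonneg_left (pow_le_pow_left₀ hbase0 (by linarith [hrate]) _) hC₁0.le
      _ ≤ C₁ * (1 - ρ) ^ N₁ := mul_le_mul_of_nonneg_left (pow_le_pow_of_le_one (by linarith) (by linarith) hn1) hC₁0.le
      _ = (2 * C₁ * (1 - ρ) ^ N₁) / 2 := by ring
      _ ≤ ε / 2 := by linarith [hg]
  -- second term `≤ ε/2`
  have hn2 : N₂ ≤ n := le_max_right _ _
  have hsecond : C₂ * Real.exp (-((1 - t) * w 0 * (t / (t + (1 - t) * w 0) * (p / 3) / K) / 4) * n) ≤ ε / 2 := by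
    have hg := exp_le_of_ge_log ha0 (by positivity : 0 < 2 * C₂) hε (n := N₂) (Nat.le_ceil _)
    rw [← hh, ← ha]
    have hmono : Real.exp (-a * n) ≤ Real.exp (-a * N₂) := by
      rw [Real.exp_le_exp]
      have : (N₂ : ℝ) ≤ n := by exact_mod_cast hn2
      have := mul_le_mul_of_nonneg_left this ha0.le
      linarith
    calc C₂ * Real.exp (-a * n) ≤ C₂ * Real.exp (-a * N₂) := mul_le_mul_of_nonneg_left hmono hC₂0.le
      _ = (2 * C₂ * Real.exp (-a * N₂)) / 2 := by ring
      _ ≤ ε / 2 := by linarith [hg]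
  refine mixingTime_le _ _ (t₀ := n) (hlaw.trans ?_)
  linarith [hfirst, hsecond]

end SlowSwap

end Summit.Ventures.LatticeQCDFlow.Scaling

end
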